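import Summits.Ventures.PercRepro.ProfileGapMonoColoopRegime

/-!
# PercRepro — THE EXACT BAND FORM OF `(★_q)`: the row `(q − 1, u − 1)` of `M ∖ z` with both boundary layers removed
(p5, gen 22; `proofs/P5-GM1.md` §18 supplement; announced INBOX 10543)

With `N := M ∖ z`, the left side of `(★_q)` splits the through-`z` demand at `m' := ρ_N(E' ∖ B')`: the terms with
`m' = u` contribute `C(u,q)` each and are exactly the lost sets (`B' ↦ E' ∖ B'`), and the rank-`q` sets with a
complement of rank `u − 1` are the co-rank-`q` rank-`(u−1)` sets with complement rank exactly `q`, which together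
with the co-rank-`(q+1)` rank-`(u−1)` sets make up `levelSetCoQ N q (u−1)`.  Hence
`StarQ M z q u ↔ Σ_{B' ∈ R_{q−1}(N), m' ≥ u+1} C(m', u−q) ≤ C(u−1,q−1) · #levelSetCoQ N (q+1) (u−1)` —
the open coloop band `u + 1 ≤ ρ(N) ≤ u + q − 1` as one precise target.  Nothing here asserts it.

* `choose_sdiff_split_ite`, `filter_levelSetCoQ_ne_eq_succ`, `card_levelSetCoQ_split_succ`,
  `sum_ite_rk_eq_eq_mul_card_lostSets`, **`starQ_iff_band`**.
-/

open scoped Matroid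

namespace PercRepro.Cogirth

open Finset ThmH Skew Shadow Profile

variable {α : Type} [DecidableEq α] {M : Matroid α} [M.Finite]

section Band

variable {N : Matroid α} [N.Finite] {q u : ℕ}

/-- The through-`z` demand of a rank-`(q−1)` set splits at `m' = u`: the terms with `m' ≥ u + 1` and `C(u,q)` when
`m' = u`. -/
theorem choose_sdiff_split_ite (hqu : q < u) (B' : Finset α) :
    (if u ≤ rk N (gr N \ B') then (rk N (gr N \ B')).choose (u - q) else 0) =
      (if u + 1 ≤ rk N (gr N \ B') then (rk N (gr N \ B')).choose (u - q) else 0) +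
        (if rk N (gr N \ B') = u then u.choose q else 0) := by
  by_cases h1 : u + 1 ≤ rk N (gr N \ B')
  · rw [if_pos (by omega), if_pos h1, if_neg (by omega), add_zero]
  · by_cases h2 : rk N (gr N \ B') = u
    · rw [if_pos h2.symm.le, if_neg h1, if_pos h2, zero_add, h2, Nat.choose_symm hqu.le]
    · rw [if_neg (by omega), if_neg h1, if_neg h2]

/-- The co-rank-`q` sets whose complement has rank `≠ q` are the co-rank-`(q+1)` sets. -/
theorem filter_levelSetCoQ_ne_eq_succ (q u : ℕ) :
    (levelSetCoQ N q u).filter (fun S => ¬ rk N (gr N \ S) = q) = levelSetCoQ N (q + 1) u := by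
  ext S
  unfold levelSetCoQ
  rw [mem_filter, mem_filter, mem_filter]
  constructor
  · rintro ⟨⟨h1, h2⟩, h3⟩
    exact ⟨h1, by omega⟩
  · rintro ⟨h1, h2⟩
    exact ⟨⟨h1, by omega⟩, by omega⟩

/-- The co-rank-`q` rank-`u` sets are those with complement rank exactly `q` plus those of co-rank `≥ q + 1`. -/
theorem card_levelSetCoQ_split_succ (q u : ℕ) :
    (levelSetCoQ N q u).card =
      ((levelSetCoQ N q u).filter (fun S => rk N (gr N \ S) = q)).card + (levelSetCoQ N (q + 1) u).card := by
  rw [← card_filter_add_card_filter_not (fun S => rk N (gr N \ S) = q) (s := levelSetCoQ N q u),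
    filter_levelSetCoQ_ne_eq_succ]

/-- The `m' = u` part of the through-`z` demand is `C(u,q)` times the number of lost sets. -/
theorem sum_ite_rk_eq_eq_mul_card_lostSets (q u : ℕ) :
    ∑ B' ∈ Rq N (q - 1), (if rk N (gr N \ B') = u then u.choose q else 0) =
      u.choose q * (lostSets N q u).card := by
  rw [sum_ite, sum_const_zero, add_zero, sum_const, smul_eq_mul,
    card_filter_Rq_eq_card_filter_levelSetCoQ (q - 1) u, filter_levelSetCoQ_pred_eq_lostSets, mul_comm]

end Band

section Coloop

variable {z : α} {q u : ℕ}

/-- **THE EXACT BAND FORM OF `(★_q)`**: `(★_q)` holds iff the through-`z` demand restricted to the rank-`(q−1)`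
sets whose complement has rank `≥ u + 1` is at most `C(u−1,q−1)` times the number of rank-`(u−1)` sets of co-rank
`≥ q + 1` in `M ∖ z` — the row `(q − 1, u − 1)` of `M ∖ z` with both boundary layers removed. -/
theorem starQ_iff_band (hqu : q < u) :
    StarQ M z q u ↔
      ∑ B' ∈ Rq (M ＼ ({z} : Set α)) (q - 1),
        (if u + 1 ≤ rk (M ＼ ({z} : Set α)) (gr (M ＼ ({z} : Set α)) \ B') then
          (rk (M ＼ ({z} : Set α)) (gr (M ＼ ({z} : Set α)) \ B')).choose (u - q) else 0) ≤
      (u - 1).choose (q - 1) * (levelSetCoQ (M ＼ ({z} : Set α)) (q + 1) (u - 1)).card := by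
  unfold StarQ
  rw [sum_congr rfl (fun B' _ => choose_sdiff_split_ite hqu B'), sum_add_distrib,
    sum_ite_rk_eq_eq_mul_card_lostSets q u, card_filter_Rq_eq_card_filter_levelSetCoQ q (u - 1),
    card_levelSetCoQ_split_succ q (u - 1)]
  constructor
  · intro h
    nlinarith [h]
  · intro h
    nlinarith [h]

end Coloop

end PercRepro.Cogirth
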